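import Summits.Ventures.YMGap.Thresholds.OneLinkHolleyStroock
import Summits.Ventures.YMGap.Thresholds.OneLinkEigenCalculus
import Mathlib.Analysis.CStarAlgebra.Matrix
import HarnessLib

/-!
# The tilt direction of Holley–Stroock for the one-link law, and the finite-cover reduction of the two one-link schemas

HONEST FRAMING.  Explicit strong-coupling bookkeeping for lattice `SU(N)` Yang–Mills (small `β`): a measure-theoretic TRANSFER and
REDUCTION lemma for ONE tilted Haar law on `SU(N)`.  It certifies nothing by itself; NOT weak coupling, NOT a continuum statement,
NOT a Yang–Mills mass-gap claim.  Cell `pub-ymgap` (venture `YMGap`), seat engine-2 (g13); the second compute-free tree lemma named in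
the lane memo `LANE-MEMO-g12.md` §3 (A) («H2 as a theorem»), after the bi-invariance / SVD reduction of `Thresholds/OneLinkLawBiInvariance.lean`.

THE OBJECT.  `ν_B(dg) ∝ exp(N Re tr(g B)) Haar_{SU(N)}(dg)`, `B ∈ M_N(ℂ)`; the two HYPOTHESIS SCHEMAS of the tree
`OneLinkVarianceBound N R v` (H2-type: `Var_{ν_B}(N Re tr(gΔ)) ≤ v‖Δ‖_F²` for all `Δ`, all `‖B‖_op ≤ R`) and `OneLinkPoincareSUN N R c`
(H1-type: `Var_{ν_B}(ψ) ≤ c M²` for every `M`-Lipschitz `ψ`, all `‖B‖_op ≤ R`).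

THE LEMMA (folklore; R. Holley, D. Stroock, J. Stat. Phys. 46 (1987) 1159–1194, bounded-perturbation lemma, in the Lipschitz form of
`Thresholds/TiltOscillationVariance.lean`).  Moving the tilt is a bounded perturbation: `ν_{B'} = (ν_B)^U` with `U(g) = N Re tr(g(B' − B))`
(`wilson_eq_tilted_wilson`), so if `U` has oscillation `≤ δ` then EVERY variance grows by at most `e^δ` from `ν_B` to `ν_{B'}`
(`variance_wilson_le_exp_mul_of_osc`); with `|U| ≤ η` pointwise, `δ = 2η` (`variance_wilson_le_exp_mul_of_near`).  Three usable `η`: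
`N√N‖B' − B‖_F` (the tree's `abs_tilt_le`), `N²‖B' − B‖_op` (`abs_pot_le_opNorm`), and — for a DIAGONAL difference, the case of the representatives
`diagonal(u·σ)` — `N Σᵢ ‖dᵢ‖` (`abs_pot_diagonal_le`).  Consequences:
* `varianceLinAt_of_near` / `poincareAt_of_near` : the H2-type bound `v` (resp. the H1-type constant `c`) AT `B` gives `e^{2η} v` (resp. `e^{2η} c`) AT `B'`;
* `varianceLinAt_diagonal_of_near` / `poincareAt_diagonal_of_near` : the same between two diagonal representatives in the `ℓ¹` metric `N Σᵢ ‖u'σ'ᵢ − uσᵢ‖`;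
* ★ `varianceLinAt_of_cover` / `poincareAt_of_cover` : on ANY set `S` of tilts, the bound `v` holds at every `B ∈ S` as soon as every `B ∈ S` is
  `η`-near some CENTRE `C i` carrying a point bound `vC i` with `e^{2ηᵢ}·vC i ≤ v` (any index type; in a certificate, `ι = Fin m`);
* ★ `oneLinkVarianceBound_of_cover` / `oneLinkPoincareSUN_of_cover` : `S` = the operator-norm ball — the schemas themselves from finitely many
  point statements + a cover.  Composed with `OneLinkBiInvariance.oneLinkVarianceBound_of_reps` the cover may be taken of the `(N+1)`-parameter
  representative set `{diagonal(u·σ) : ‖u‖ = 1, 0 ≤ σᵢ ≤ R}` in the `ℓ¹` metric above (that composition is one line and is left to the file that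
  imports both).
After this file, «H2 as a theorem» for a given `(N, R, v)` is EXACTLY: a finite list of certified point bounds `Var_{ν_{Cᵢ}} ≤ vCᵢ` + the decidable
cover inequalities.  No number of any ledger moves here.

References: Holley–Stroock 1987 (perturbation lemma); H. Shen, R. Zhu, X. Zhu, CMP 400 (2023) (the one-link law and its Bakry–Émery constant,
the schemas' known inhabitant).
-/

noncomputable section

open MeasureTheory ProbabilityTheory Real Matrix
open scoped BigOperators
open Literature.MathematicalPhysics.QuantumFieldTheory
open Literature.MathematicalPhysics.QuantumFieldTheory.SUNBakryEmery (SUN SUN.mem_unitaryGroup continuous_of_lipschitz_suFrobDist)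
open Summit.QuantumFields.BalabanUV.InfraRed.StrongCouplingVarianceDoorSUN (OneLinkVarianceBound)
open Summit.QuantumFields.BalabanUV.InfraRed.StrongCouplingPoincareDoorSUN (OneLinkPoincareSUN)
open Summit.Ventures.YMGap.TiltOscillationVariance
open Summit.Ventures.YMGap.OneLinkHolleyStroock

namespace Summit.Ventures.YMGap.OneLinkCoverReduction

variable {N : ℕ}

/-! ## 1. Moving the tilt is a bounded perturbation: `ν_{B'} = (ν_B)^{N Re tr(g(B'−B))}` -/

/-- `N Re tr(g B') = N Re tr(g B) + N Re tr(g (B' − B))`. [folklore] -/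
theorem pot_eq_pot_add_pot_sub (B B' : Matrix (Fin N) (Fin N) ℂ) (g : SUN N) :
    (N : ℝ) * ((g : Matrix (Fin N) (Fin N) ℂ) * B').trace.re =
      (N : ℝ) * ((g : Matrix (Fin N) (Fin N) ℂ) * B).trace.re + (N : ℝ) * ((g : Matrix (Fin N) (Fin N) ℂ) * (B' - B)).trace.re := by
  rw [Matrix.mul_sub, Matrix.trace_sub, Complex.sub_re]
  ring

/-- **`ν_{B'}` is the `U`-tilt of `ν_B` with `U(g) = N Re tr(g (B' − B))`.** [folklore] -/
theorem wilson_eq_tilted_wilson (B B' : Matrix (Fin N) (Fin N) ℂ) :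
    ((haarProbability (SUN N)).tilted fun g : SUN N => (N : ℝ) * ((g : Matrix (Fin N) (Fin N) ℂ) * B').trace.re) =
      ((haarProbability (SUN N)).tilted fun g : SUN N => (N : ℝ) * ((g : Matrix (Fin N) (Fin N) ℂ) * B).trace.re).tilted
        fun g : SUN N => (N : ℝ) * ((g : Matrix (Fin N) (Fin N) ℂ) * (B' - B)).trace.re := by
  rw [← pert_eq_tilted_tilted]
  congr 1
  funext g
  exact pot_eq_pot_add_pot_sub B B' g

/-! ## 2. Three bounds for the perturbation `U(g) = N Re tr(g D)`, `D = B' − B` -/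

/-- Operator-norm form: `|N Re tr(g D)| ≤ N² ‖D‖_op` (Frobenius form `≤ N√N‖D‖_F` = the tree's `OneLinkHolleyStroock.abs_tilt_le`, then
`‖D‖_F ≤ √N‖D‖_op` = the tree's `OneLinkEigen.frobNorm_le_sqrt_mul_matrixOpNorm`). [folklore] -/
theorem abs_pot_le_opNorm (D : Matrix (Fin N) (Fin N) ℂ) (g : SUN N) :
    |(N : ℝ) * ((g : Matrix (Fin N) (Fin N) ℂ) * D).trace.re| ≤ (N : ℝ) * ((N : ℝ) * matrixOpNorm D) := by
  refine (abs_tilt_le D g).trans (mul_le_mul_of_nonneg_left ?_ (Nat.cast_nonneg N))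
  calc Real.sqrt N * frobNorm D ≤ Real.sqrt N * (Real.sqrt N * matrixOpNorm D) :=
        mul_le_mul_of_nonneg_left (OneLinkEigen.frobNorm_le_sqrt_mul_matrixOpNorm D) (Real.sqrt_nonneg _)
    _ = (N : ℝ) * matrixOpNorm D := by
        rw [← mul_assoc, Real.mul_self_sqrt (Nat.cast_nonneg N)]

/-- `tr(g · diagonal d) = Σᵢ gᵢᵢ dᵢ`. [folklore] -/
theorem trace_mul_diagonal (M : Matrix (Fin N) (Fin N) ℂ) (d : Fin N → ℂ) :
    (M * diagonal d).trace = ∑ i, M i i * d i := by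
  simp only [Matrix.trace, Matrix.diag_apply, Matrix.mul_diagonal]

/-- Diagonal (`ℓ¹`) form: `|N Re tr(g · diagonal d)| ≤ N Σᵢ ‖dᵢ‖` on `SU(N)` (`|gᵢᵢ| ≤ 1`). [folklore] -/
theorem abs_pot_diagonal_le (d : Fin N → ℂ) (g : SUN N) :
    |(N : ℝ) * ((g : Matrix (Fin N) (Fin N) ℂ) * diagonal d).trace.re| ≤ (N : ℝ) * ∑ i, ‖d i‖ := by
  rw [abs_mul, abs_of_nonneg (Nat.cast_nonneg N)]
  refine mul_le_mul_of_nonneg_left ?_ (Nat.cast_nonneg N)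
  rw [trace_mul_diagonal]
  calc |(∑ i, (g : Matrix (Fin N) (Fin N) ℂ) i i * d i).re| ≤ ‖∑ i, (g : Matrix (Fin N) (Fin N) ℂ) i i * d i‖ :=
        Complex.abs_re_le_norm _
    _ ≤ ∑ i, ‖(g : Matrix (Fin N) (Fin N) ℂ) i i * d i‖ := norm_sum_le _ _
    _ ≤ ∑ i, ‖d i‖ := Finset.sum_le_sum fun i _ => by
        rw [norm_mul]
        calc ‖(g : Matrix (Fin N) (Fin N) ℂ) i i‖ * ‖d i‖ ≤ 1 * ‖d i‖ :=
              mul_le_mul_of_nonneg_right (entry_norm_bound_of_unitary (SUN.mem_unitaryGroup g) i i) (norm_nonneg _)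
          _ = ‖d i‖ := one_mul _

/-- The difference of two representatives is diagonal: `diagonal(u'·σ') − diagonal(u·σ) = diagonal(u'σ' − uσ)`. [folklore] -/
theorem diagonal_rep_sub (u u' : ℂ) (σ σ' : Fin N → ℝ) :
    diagonal (fun i => u' * ((σ' i : ℝ) : ℂ)) - diagonal (fun i => u * ((σ i : ℝ) : ℂ)) =
      diagonal (fun i => u' * ((σ' i : ℝ) : ℂ) - u * ((σ i : ℝ) : ℂ)) := by
  rw [← diagonal_sub]

/-- A pointwise bound `|U| ≤ η` gives oscillation `≤ 2η`. [folklore] -/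
theorem osc_of_abs_le {S : Type*} {U : S → ℝ} {η : ℝ} (h : ∀ s, |U s| ≤ η) (s s' : S) : U s ≤ U s' + 2 * η := by
  have h1 := (abs_le.1 (h s)).2
  have h2 := (abs_le.1 (h s')).1
  linarith

/-! ## 3. The transfer: every variance grows by at most `e^{osc}` from `ν_B` to `ν_{B'}` -/

/-- **Holley–Stroock, tilt direction, oscillation form**: if `U(g) = N Re tr(g (B' − B))` has oscillation `≤ δ` on `SU(N)`, then for every bounded
measurable `X`, `Var_{ν_{B'}}(X) ≤ e^δ · Var_{ν_B}(X)`. [folklore] -/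
theorem variance_wilson_le_exp_mul_of_osc {B B' : Matrix (Fin N) (Fin N) ℂ} {δ : ℝ}
    (hosc : ∀ g h : SUN N, (N : ℝ) * ((g : Matrix (Fin N) (Fin N) ℂ) * (B' - B)).trace.re ≤
      (N : ℝ) * ((h : Matrix (Fin N) (Fin N) ℂ) * (B' - B)).trace.re + δ)
    {X : SUN N → ℝ} (hXm : Measurable X) (hXb : ∃ C, ∀ g, |X g| ≤ C) :
    Var[X; (haarProbability (SUN N)).tilted fun g : SUN N => (N : ℝ) * ((g : Matrix (Fin N) (Fin N) ℂ) * B').trace.re] ≤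
      exp δ * Var[X; (haarProbability (SUN N)).tilted fun g : SUN N => (N : ℝ) * ((g : Matrix (Fin N) (Fin N) ℂ) * B).trace.re] := by
  haveI := isProbabilityMeasure_wilson (N := N) B
  rw [wilson_eq_tilted_wilson B B']
  exact variance_tilted_le_exp_mul (measurable_tilt (B' - B)) ⟨_, abs_tilt_le (B' - B)⟩ hosc hXm hXb

/-- **Holley–Stroock, tilt direction, sup form**: if `|N Re tr(g (B' − B))| ≤ η` on `SU(N)`, then `Var_{ν_{B'}}(X) ≤ e^{2η} · Var_{ν_B}(X)` for every
bounded measurable `X`. [folklore] -/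
theorem variance_wilson_le_exp_mul_of_near {B B' : Matrix (Fin N) (Fin N) ℂ} {η : ℝ}
    (hη : ∀ g : SUN N, |(N : ℝ) * ((g : Matrix (Fin N) (Fin N) ℂ) * (B' - B)).trace.re| ≤ η)
    {X : SUN N → ℝ} (hXm : Measurable X) (hXb : ∃ C, ∀ g, |X g| ≤ C) :
    Var[X; (haarProbability (SUN N)).tilted fun g : SUN N => (N : ℝ) * ((g : Matrix (Fin N) (Fin N) ℂ) * B').trace.re] ≤
      exp (2 * η) * Var[X; (haarProbability (SUN N)).tilted fun g : SUN N => (N : ℝ) * ((g : Matrix (Fin N) (Fin N) ℂ) * B).trace.re] :=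
  variance_wilson_le_exp_mul_of_osc (osc_of_abs_le hη) hXm hXb

/-! ## 4. The H2-type bound and the H1-type constant AT a point transfer to nearby points -/

/-- **H2 AT `B` ⇒ H2 AT `B'` with `e^{2η}`**: if `Var_{ν_B}(N Re tr(gΔ)) ≤ v‖Δ‖_F²` for all `Δ` and `|N Re tr(g(B' − B))| ≤ η` on `SU(N)`, then
`Var_{ν_{B'}}(N Re tr(gΔ)) ≤ e^{2η} v ‖Δ‖_F²` for all `Δ`. [folklore] -/
theorem varianceLinAt_of_near {B B' : Matrix (Fin N) (Fin N) ℂ} {v η : ℝ}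
    (hv : ∀ Δ : Matrix (Fin N) (Fin N) ℂ,
      Var[fun g : SUN N => (N : ℝ) * ((g : Matrix (Fin N) (Fin N) ℂ) * Δ).trace.re ;
        (haarProbability (SUN N)).tilted fun g : SUN N => (N : ℝ) * ((g : Matrix (Fin N) (Fin N) ℂ) * B).trace.re] ≤ v * frobNorm Δ ^ 2)
    (hη : ∀ g : SUN N, |(N : ℝ) * ((g : Matrix (Fin N) (Fin N) ℂ) * (B' - B)).trace.re| ≤ η)
    (Δ : Matrix (Fin N) (Fin N) ℂ) :
    Var[fun g : SUN N => (N : ℝ) * ((g : Matrix (Fin N) (Fin N) ℂ) * Δ).trace.re ;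
        (haarProbability (SUN N)).tilted fun g : SUN N => (N : ℝ) * ((g : Matrix (Fin N) (Fin N) ℂ) * B').trace.re]
      ≤ exp (2 * η) * v * frobNorm Δ ^ 2 := by
  rw [mul_assoc]
  exact (variance_wilson_le_exp_mul_of_near hη (measurable_tilt Δ) ⟨_, abs_tilt_le Δ⟩).trans
    (mul_le_mul_of_nonneg_left (hv Δ) (exp_pos _).le)

/-- **H1 AT `B` ⇒ H1 AT `B'` with `e^{2η}`**: if every `M`-Lipschitz `ψ` has `Var_{ν_B}(ψ) ≤ c M²` and `|N Re tr(g(B' − B))| ≤ η` on `SU(N)`,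
then every `M`-Lipschitz `ψ` has `Var_{ν_{B'}}(ψ) ≤ e^{2η} c M²`. [folklore] -/
theorem poincareAt_of_near {B B' : Matrix (Fin N) (Fin N) ℂ} {c η : ℝ}
    (hc : ∀ (ψ : SUN N → ℝ) (M : ℝ), 0 ≤ M → (∀ a b : SUN N, |ψ a - ψ b| ≤ M * suFrobDist a b) →
      Var[ψ ; (haarProbability (SUN N)).tilted fun g : SUN N => (N : ℝ) * ((g : Matrix (Fin N) (Fin N) ℂ) * B).trace.re] ≤ c * M ^ 2)
    (hη : ∀ g : SUN N, |(N : ℝ) * ((g : Matrix (Fin N) (Fin N) ℂ) * (B' - B)).trace.re| ≤ η)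
    (ψ : SUN N → ℝ) (M : ℝ) (hM : 0 ≤ M) (hψ : ∀ a b : SUN N, |ψ a - ψ b| ≤ M * suFrobDist a b) :
    Var[ψ ; (haarProbability (SUN N)).tilted fun g : SUN N => (N : ℝ) * ((g : Matrix (Fin N) (Fin N) ℂ) * B').trace.re]
      ≤ exp (2 * η) * c * M ^ 2 := by
  have hψm : Measurable ψ := (continuous_of_lipschitz_suFrobDist hψ).measurable
  rw [mul_assoc]
  exact (variance_wilson_le_exp_mul_of_near hη hψm (exists_abs_le_of_lipschitz hψ)).trans
    (mul_le_mul_of_nonneg_left (hc ψ M hM hψ) (exp_pos _).le)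

/-- **H2 between two diagonal representatives** (`ℓ¹` metric): a bound `v` at `diagonal(u·σ)` gives `e^{2η} v` at `diagonal(u'·σ')` whenever
`N Σᵢ ‖u'σ'ᵢ − uσᵢ‖ ≤ η`. [folklore] -/
theorem varianceLinAt_diagonal_of_near {u u' : ℂ} {σ σ' : Fin N → ℝ} {v η : ℝ}
    (hv : ∀ Δ : Matrix (Fin N) (Fin N) ℂ,
      Var[fun g : SUN N => (N : ℝ) * ((g : Matrix (Fin N) (Fin N) ℂ) * Δ).trace.re ;
        (haarProbability (SUN N)).tilted fun g : SUN N =>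
          (N : ℝ) * ((g : Matrix (Fin N) (Fin N) ℂ) * diagonal (fun i => u * ((σ i : ℝ) : ℂ))).trace.re] ≤ v * frobNorm Δ ^ 2)
    (hη : (N : ℝ) * ∑ i, ‖u' * ((σ' i : ℝ) : ℂ) - u * ((σ i : ℝ) : ℂ)‖ ≤ η) (Δ : Matrix (Fin N) (Fin N) ℂ) :
    Var[fun g : SUN N => (N : ℝ) * ((g : Matrix (Fin N) (Fin N) ℂ) * Δ).trace.re ;
        (haarProbability (SUN N)).tilted fun g : SUN N =>
          (N : ℝ) * ((g : Matrix (Fin N) (Fin N) ℂ) * diagonal (fun i => u' * ((σ' i : ℝ) : ℂ))).trace.re]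
      ≤ exp (2 * η) * v * frobNorm Δ ^ 2 :=
  varianceLinAt_of_near hv (fun g => by rw [diagonal_rep_sub]; exact (abs_pot_diagonal_le _ g).trans hη) Δ

/-- **H1 between two diagonal representatives** (`ℓ¹` metric): a Lipschitz Poincaré constant `c` at `diagonal(u·σ)` gives `e^{2η} c` at
`diagonal(u'·σ')` whenever `N Σᵢ ‖u'σ'ᵢ − uσᵢ‖ ≤ η`. [folklore] -/
theorem poincareAt_diagonal_of_near {u u' : ℂ} {σ σ' : Fin N → ℝ} {c η : ℝ}
    (hc : ∀ (ψ : SUN N → ℝ) (M : ℝ), 0 ≤ M → (∀ a b : SUN N, |ψ a - ψ b| ≤ M * suFrobDist a b) →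
      Var[ψ ; (haarProbability (SUN N)).tilted fun g : SUN N =>
        (N : ℝ) * ((g : Matrix (Fin N) (Fin N) ℂ) * diagonal (fun i => u * ((σ i : ℝ) : ℂ))).trace.re] ≤ c * M ^ 2)
    (hη : (N : ℝ) * ∑ i, ‖u' * ((σ' i : ℝ) : ℂ) - u * ((σ i : ℝ) : ℂ)‖ ≤ η)
    (ψ : SUN N → ℝ) (M : ℝ) (hM : 0 ≤ M) (hψ : ∀ a b : SUN N, |ψ a - ψ b| ≤ M * suFrobDist a b) :
    Var[ψ ; (haarProbability (SUN N)).tilted fun g : SUN N =>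
        (N : ℝ) * ((g : Matrix (Fin N) (Fin N) ℂ) * diagonal (fun i => u' * ((σ' i : ℝ) : ℂ))).trace.re]
      ≤ exp (2 * η) * c * M ^ 2 :=
  poincareAt_of_near hc (fun g => by rw [diagonal_rep_sub]; exact (abs_pot_diagonal_le _ g).trans hη) ψ M hM hψ

/-! ## 5. ★ The finite-cover reduction -/

/-- ★ **H2 on a set from point statements + a cover.**  Let `S` be any set of tilts.  Suppose centres `C i` carry point bounds
`Var_{ν_{C i}}(N Re tr(gΔ)) ≤ vC i · ‖Δ‖_F²` (all `Δ`), and every `B ∈ S` is `η i`-near some centre (`|N Re tr(g(B − C i))| ≤ η i` on `SU(N)`)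
with `e^{2 η i} · vC i ≤ v`.  Then `Var_{ν_B}(N Re tr(gΔ)) ≤ v‖Δ‖_F²` for every `B ∈ S` and every `Δ`.  (In a certificate `ι = Fin m`.) [folklore] -/
theorem varianceLinAt_of_cover {ι : Sort*} {S : Set (Matrix (Fin N) (Fin N) ℂ)} {v : ℝ}
    (C : ι → Matrix (Fin N) (Fin N) ℂ) (vC η : ι → ℝ)
    (hcert : ∀ (i : ι) (Δ : Matrix (Fin N) (Fin N) ℂ),
      Var[fun g : SUN N => (N : ℝ) * ((g : Matrix (Fin N) (Fin N) ℂ) * Δ).trace.re ;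
        (haarProbability (SUN N)).tilted fun g : SUN N => (N : ℝ) * ((g : Matrix (Fin N) (Fin N) ℂ) * C i).trace.re] ≤ vC i * frobNorm Δ ^ 2)
    (hcover : ∀ B ∈ S, ∃ i : ι, (∀ g : SUN N, |(N : ℝ) * ((g : Matrix (Fin N) (Fin N) ℂ) * (B - C i)).trace.re| ≤ η i) ∧
      exp (2 * η i) * vC i ≤ v)
    {B : Matrix (Fin N) (Fin N) ℂ} (hB : B ∈ S) (Δ : Matrix (Fin N) (Fin N) ℂ) :
    Var[fun g : SUN N => (N : ℝ) * ((g : Matrix (Fin N) (Fin N) ℂ) * Δ).trace.re ;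
        (haarProbability (SUN N)).tilted fun g : SUN N => (N : ℝ) * ((g : Matrix (Fin N) (Fin N) ℂ) * B).trace.re] ≤ v * frobNorm Δ ^ 2 := by
  obtain ⟨i, hnear, hvi⟩ := hcover B hB
  exact (varianceLinAt_of_near (hcert i) hnear Δ).trans (mul_le_mul_of_nonneg_right hvi (sq_nonneg _))

/-- ★ **H1 on a set from point statements + a cover**: as `varianceLinAt_of_cover`, for the Lipschitz Poincaré constant. [folklore] -/
theorem poincareAt_of_cover {ι : Sort*} {S : Set (Matrix (Fin N) (Fin N) ℂ)} {c : ℝ}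
    (C : ι → Matrix (Fin N) (Fin N) ℂ) (cC η : ι → ℝ)
    (hcert : ∀ (i : ι) (ψ : SUN N → ℝ) (M : ℝ), 0 ≤ M → (∀ a b : SUN N, |ψ a - ψ b| ≤ M * suFrobDist a b) →
      Var[ψ ; (haarProbability (SUN N)).tilted fun g : SUN N => (N : ℝ) * ((g : Matrix (Fin N) (Fin N) ℂ) * C i).trace.re] ≤ cC i * M ^ 2)
    (hcover : ∀ B ∈ S, ∃ i : ι, (∀ g : SUN N, |(N : ℝ) * ((g : Matrix (Fin N) (Fin N) ℂ) * (B - C i)).trace.re| ≤ η i) ∧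
      exp (2 * η i) * cC i ≤ c)
    {B : Matrix (Fin N) (Fin N) ℂ} (hB : B ∈ S) (ψ : SUN N → ℝ) (M : ℝ) (hM : 0 ≤ M)
    (hψ : ∀ a b : SUN N, |ψ a - ψ b| ≤ M * suFrobDist a b) :
    Var[ψ ; (haarProbability (SUN N)).tilted fun g : SUN N => (N : ℝ) * ((g : Matrix (Fin N) (Fin N) ℂ) * B).trace.re] ≤ c * M ^ 2 := by
  obtain ⟨i, hnear, hci⟩ := hcover B hB
  exact (poincareAt_of_near (hcert i) hnear ψ M hM hψ).trans (mul_le_mul_of_nonneg_right hci (sq_nonneg _))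

/-- ★ **`OneLinkVarianceBound N R v` from finitely many point statements + a cover of the operator-norm ball.** [folklore] -/
theorem oneLinkVarianceBound_of_cover {ι : Sort*} {R v : ℝ} (C : ι → Matrix (Fin N) (Fin N) ℂ) (vC η : ι → ℝ)
    (hcert : ∀ (i : ι) (Δ : Matrix (Fin N) (Fin N) ℂ),
      Var[fun g : SUN N => (N : ℝ) * ((g : Matrix (Fin N) (Fin N) ℂ) * Δ).trace.re ;
        (haarProbability (SUN N)).tilted fun g : SUN N => (N : ℝ) * ((g : Matrix (Fin N) (Fin N) ℂ) * C i).trace.re] ≤ vC i * frobNorm Δ ^ 2)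
    (hcover : ∀ B : Matrix (Fin N) (Fin N) ℂ, matrixOpNorm B ≤ R →
      ∃ i : ι, (∀ g : SUN N, |(N : ℝ) * ((g : Matrix (Fin N) (Fin N) ℂ) * (B - C i)).trace.re| ≤ η i) ∧ exp (2 * η i) * vC i ≤ v) :
    OneLinkVarianceBound N R v := fun _ hB Δ =>
  varianceLinAt_of_cover (S := {B | matrixOpNorm B ≤ R}) C vC η hcert (fun B hB => hcover B hB) hB Δ

/-- ★ **`OneLinkPoincareSUN N R c` from finitely many point statements + a cover of the operator-norm ball.** [folklore] -/
theorem oneLinkPoincareSUN_of_cover {ι : Sort*} {R c : ℝ} (C : ι → Matrix (Fin N) (Fin N) ℂ) (cC η : ι → ℝ)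
    (hcert : ∀ (i : ι) (ψ : SUN N → ℝ) (M : ℝ), 0 ≤ M → (∀ a b : SUN N, |ψ a - ψ b| ≤ M * suFrobDist a b) →
      Var[ψ ; (haarProbability (SUN N)).tilted fun g : SUN N => (N : ℝ) * ((g : Matrix (Fin N) (Fin N) ℂ) * C i).trace.re] ≤ cC i * M ^ 2)
    (hcover : ∀ B : Matrix (Fin N) (Fin N) ℂ, matrixOpNorm B ≤ R →
      ∃ i : ι, (∀ g : SUN N, |(N : ℝ) * ((g : Matrix (Fin N) (Fin N) ℂ) * (B - C i)).trace.re| ≤ η i) ∧ exp (2 * η i) * cC i ≤ c) :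
    OneLinkPoincareSUN N R c := fun _ hB ψ M hM hψ =>
  poincareAt_of_cover (S := {B | matrixOpNorm B ≤ R}) C cC η hcert (fun B hB => hcover B hB) hB ψ M hM hψ

/-- **Operator-norm covers suffice**: a cover of the ball by operator-norm balls of radii `r i` around the centres is an `η`-cover with
`η i = N² r i`. [folklore] -/
theorem oneLinkVarianceBound_of_opNorm_cover {ι : Sort*} {R v : ℝ} (C : ι → Matrix (Fin N) (Fin N) ℂ) (vC r : ι → ℝ)
    (hcert : ∀ (i : ι) (Δ : Matrix (Fin N) (Fin N) ℂ),
      Var[fun g : SUN N => (N : ℝ) * ((g : Matrix (Fin N) (Fin N) ℂ) * Δ).trace.re ;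
        (haarProbability (SUN N)).tilted fun g : SUN N => (N : ℝ) * ((g : Matrix (Fin N) (Fin N) ℂ) * C i).trace.re] ≤ vC i * frobNorm Δ ^ 2)
    (hcover : ∀ B : Matrix (Fin N) (Fin N) ℂ, matrixOpNorm B ≤ R →
      ∃ i : ι, matrixOpNorm (B - C i) ≤ r i ∧ exp (2 * ((N : ℝ) * ((N : ℝ) * r i))) * vC i ≤ v) :
    OneLinkVarianceBound N R v := by
  refine oneLinkVarianceBound_of_cover C vC (fun i => (N : ℝ) * ((N : ℝ) * r i)) hcert fun B hB => ?_
  obtain ⟨i, hr, hvi⟩ := hcover B hB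
  exact ⟨i, fun g => (abs_pot_le_opNorm _ g).trans (mul_le_mul_of_nonneg_left
    (mul_le_mul_of_nonneg_left hr (Nat.cast_nonneg N)) (Nat.cast_nonneg N)), hvi⟩

/-! ## 6. The cover may be taken of the representatives `diagonal(u·σ)` in the `ℓ¹` metric -/

/-- ★ **H2 at every representative from point statements at representative centres + an `ℓ¹` cover.**  Centres `diagonal(uC i · σC i)` with
point bounds `vC i`; every representative `diagonal(u·σ)`, `‖u‖ = 1`, `0 ≤ σⱼ ≤ R`, within `N Σⱼ ‖uσⱼ − uC i σC i j‖ ≤ η i` of some centre with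
`e^{2 η i} vC i ≤ v`.  The conclusion is VERBATIM the hypothesis of `OneLinkBiInvariance.oneLinkVarianceBound_of_reps`, which then gives
`OneLinkVarianceBound N R v`. [folklore] -/
theorem varianceLinAt_reps_of_cover {ι : Sort*} {R v : ℝ} (uC : ι → ℂ) (σC : ι → Fin N → ℝ) (vC η : ι → ℝ)
    (hcert : ∀ (i : ι) (Δ : Matrix (Fin N) (Fin N) ℂ),
      Var[fun g : SUN N => (N : ℝ) * ((g : Matrix (Fin N) (Fin N) ℂ) * Δ).trace.re ;
        (haarProbability (SUN N)).tilted fun g : SUN N =>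
          (N : ℝ) * ((g : Matrix (Fin N) (Fin N) ℂ) * diagonal (fun j => uC i * ((σC i j : ℝ) : ℂ))).trace.re] ≤ vC i * frobNorm Δ ^ 2)
    (hcover : ∀ (u : ℂ) (σ : Fin N → ℝ), ‖u‖ = 1 → (∀ j, 0 ≤ σ j) → (∀ j, σ j ≤ R) →
      ∃ i : ι, (N : ℝ) * ∑ j, ‖u * ((σ j : ℝ) : ℂ) - uC i * ((σC i j : ℝ) : ℂ)‖ ≤ η i ∧ exp (2 * η i) * vC i ≤ v)
    (u : ℂ) (σ : Fin N → ℝ) (hu : ‖u‖ = 1) (hσ0 : ∀ j, 0 ≤ σ j) (hσR : ∀ j, σ j ≤ R) (Δ : Matrix (Fin N) (Fin N) ℂ) :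
    Var[fun g : SUN N => (N : ℝ) * ((g : Matrix (Fin N) (Fin N) ℂ) * Δ).trace.re ;
        (haarProbability (SUN N)).tilted fun g : SUN N =>
          (N : ℝ) * ((g : Matrix (Fin N) (Fin N) ℂ) * diagonal (fun j => u * ((σ j : ℝ) : ℂ))).trace.re] ≤ v * frobNorm Δ ^ 2 := by
  obtain ⟨i, hnear, hvi⟩ := hcover u σ hu hσ0 hσR
  exact (varianceLinAt_diagonal_of_near (hcert i) hnear Δ).trans (mul_le_mul_of_nonneg_right hvi (sq_nonneg _))

/-- ★ **H1 at every representative from point statements at representative centres + an `ℓ¹` cover** — the conclusion is VERBATIM the hypothesis of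
`OneLinkBiInvariance.oneLinkPoincareSUN_of_reps`. [folklore] -/
theorem poincareAt_reps_of_cover {ι : Sort*} {R c : ℝ} (uC : ι → ℂ) (σC : ι → Fin N → ℝ) (cC η : ι → ℝ)
    (hcert : ∀ (i : ι) (ψ : SUN N → ℝ) (M : ℝ), 0 ≤ M → (∀ a b : SUN N, |ψ a - ψ b| ≤ M * suFrobDist a b) →
      Var[ψ ; (haarProbability (SUN N)).tilted fun g : SUN N =>
        (N : ℝ) * ((g : Matrix (Fin N) (Fin N) ℂ) * diagonal (fun j => uC i * ((σC i j : ℝ) : ℂ))).trace.re] ≤ cC i * M ^ 2)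
    (hcover : ∀ (u : ℂ) (σ : Fin N → ℝ), ‖u‖ = 1 → (∀ j, 0 ≤ σ j) → (∀ j, σ j ≤ R) →
      ∃ i : ι, (N : ℝ) * ∑ j, ‖u * ((σ j : ℝ) : ℂ) - uC i * ((σC i j : ℝ) : ℂ)‖ ≤ η i ∧ exp (2 * η i) * cC i ≤ c)
    (u : ℂ) (σ : Fin N → ℝ) (hu : ‖u‖ = 1) (hσ0 : ∀ j, 0 ≤ σ j) (hσR : ∀ j, σ j ≤ R)
    (ψ : SUN N → ℝ) (M : ℝ) (hM : 0 ≤ M) (hψ : ∀ a b : SUN N, |ψ a - ψ b| ≤ M * suFrobDist a b) :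
    Var[ψ ; (haarProbability (SUN N)).tilted fun g : SUN N =>
        (N : ℝ) * ((g : Matrix (Fin N) (Fin N) ℂ) * diagonal (fun j => u * ((σ j : ℝ) : ℂ))).trace.re] ≤ c * M ^ 2 := by
  obtain ⟨i, hnear, hci⟩ := hcover u σ hu hσ0 hσR
  exact (poincareAt_diagonal_of_near (hcert i) hnear ψ M hM hψ).trans (mul_le_mul_of_nonneg_right hci (sq_nonneg _))

end Summit.Ventures.YMGap.OneLinkCoverReduction

end
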